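import Summits.QuantumFields.YangMills.Theorems.BalabanUVNodesN07DataDownTheTower
import HarnessLib

/-!
# DAG node N07 [B11] — (145) AT THE REPRESENTATIVE, PER FINE BOND: the size of a FINE bond variable `U′(b)` is read off the CHAIN OF FACES it crosses — `b = c₀`, `c_{i+1} := ⟨blockOf (c_i)₋, dir b⟩`
# while the blocks of the two ends differ — by n07-w5's Lemma 1 ([6] (1.25)) once per crossed level: `dist1 (U′ b) ≤ dist1 (M^m U′(c_m)) + Σ_{i<m} (7t_i + (d+1)(L−1)τ_i)`, and the chain
# STOPS at the first level `m` where the ends share a block (within-block letter `τ_m`) or at the top (`v_k`): the per-fine-bond letter «by the coarsest crossed face» that n07-w8 g5's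
# variation door (`hvarU`, LOCATED-CRUDE-SHEAR-LETTER) sums along fine paths — print's «|U′_k(x,x′) − 1| < |x − y|·2L²ε₀» mechanism, contour-agnostic

Cell `pub-ymgap` (HUMAN RULINGS D-0062 ∕ D-0088 ∕ D-0149), width seat `pub-ymgap-dag-n07-w6` (second wave), harness re-seat g0″, 2026-08-28; CLAIM-7 (own lineage FILE 5 `…DataDownTheTower`; n07-w8 g5 ASK «aim the
radial-tower work at `hvarU` (fine form)», lane owner's ROAD WORD (S)).  `--kind proof --supports stmt-QuantumFields-27364 --as helper` (K1⁹ per dag-lead KEY MAP v2; count-neutral).  THEOREMS ONLY.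

THE PRINT.  [B11] = [Balaban1985Variational] p. 300–301: «U′_k ∈ Ax_k(□̃(k), 1) … and the generalized axial gauge conditions imply |U′_k(x, x′) − 1| < |x − y|2L²ε₀ ≤ … ≤ 8dL²Mε₀ (145) for
⟨x, x′⟩ ⊂ □̃(k)»; [6] = [Balaban1985RegularSpaces] (1.15) p. 78, Lemma 1 (1.23)–(1.25) p. 79; [I] (0.3) p. 252.

WHAT THIS FILE DOES (lattice bookkeeping + by-name composition; NOTHING of [B11]∕[6] analysis asserted).
* §1 THE CHAIN OF A FINE BOND (generic `P`): `chain_tgt` — if the ends of the fine bond `b` have different block points at every height `≤ m` (`iterBlockOf (i+1) b₋ ≠ iterBlockOf (i+1) b₊`, `i < m`),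
  then the level-`m` chain bond `c_m := ⟨iterBlockOf m b₋, dir b⟩` ends at `iterBlockOf m b₊` (induction with FILE 5's `exists_coarse_of_crossing`); `chain_mem_window` — under windows nested under
  blocking the chain stays in the windows.
* §2 ★★★ `dist1_fine_le_chain` — THE DESCENT ALONG THE CHAIN at `W := M^i U′` (any `U′`, `m ≤ m_P + K_P`… standing range `m ≤ m + K`): with per-level plaquette letters `a_i` around the chain bond
  `c_{i+1}` (`t_i := ((d+2)L)²∕4·a_i < δ_N`) and within-block letters `τ_i` at the two blocks of `c_{i+1}` (both quantified over windows `W (i+1)` containing the chain, as in FILE 5),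
  `dist1 (U′ b) ≤ dist1 (M^m U′ (c_m)) + Σ_{i<m} (7t_i + (d+1)(L−1)τ_i)` — n07-w5's `dist1_crossingBond_le_at_record` once per level (`M^{i+1} = (avOfRecord i).avg ∘ M^i` by `rfl`).
* §3 THE TWO TERMINATIONS: ★★★ `dist1_fine_le_of_coarsestFace` — if moreover the ends SHARE their block point at height `m + 1` (the coarsest crossed face has level `m`), the chain bond `c_m` is a
  within-block bond and `dist1 (U′ b) ≤ τ_m + Σ_{i<m} (…)` — the letter DECAYS with the level of the coarsest crossed face (for the radial tower `τ_i`, `t_i` are level-`i` plaquette letters);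
  ★★ `dist1_fine_le_of_top` — if the chain reaches the top `m = k`, `dist1 (U′ b) ≤ v_k + Σ_{i<k} (…)` with the top letter on the top window; `dist1_fine_le_within` (`m = 0`: same fine block,
  `≤ τ₀`).
* §4 (A6) `chain_letters_one` — at `U′ = 1` every letter holds with `τ ≡ 0`, `v ≡ 0`, any `a_i > 0` (p613938 `dist1_iter_avOfRecord_one`, FILE 5 `plaq_down_the_tower_one` by name).

HONEST FRAMING (binding).  Count-neutral helper; by-name composition of LANDED theorems (this base FILE 5, dag-n07-w5 `…Lemma1CrossingBondsAtRecord` ∕ `…Lemma1CrossingBonds`, lit `B5Eq118OneStroke.iterBlockOf`);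
the per-level plaquette letters (7), the within-block letters `τ_i` (data lane, radial tower), the top letter and the windows are HYPOTHESES; the crossing COUNT along fine paths and the sum over a
path (n07-w8 g5's §1 socket `dist1_toMS_path_le_sum`) are NOT here; nothing of [B11]∕[6] analysis asserted; `stub_prop8StepCoP13` ∕ K0⁷ ∕ K1⁹ NOT closed; N07 NOT discharged; the chair's tally of record
is the only count; **no summit statement is proved by this seat** — one finite `T⁴` programme at fixed `ε`, Bałaban AS PRINTED; the route closes the conditional finite-𝕋⁴ rung `BalabanLadder.UV` only;
NOT continuum ∕ ℝ⁴ ∕ OS ∕ mass gap ∕ Clay.  No `sorry`, no `def`, no `instance`, no `notation`.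
-/

noncomputable section

namespace Summit.QuantumFields.YangMills.BalabanUVNodes.N07FineBondByCoarsestFace

open scoped Matrix.Norms.L2Operator BigOperators
open Literature.MathematicalPhysics.QuantumFieldTheory.Balaban1983to89
open Literature.MathematicalPhysics.QuantumFieldTheory.Balaban1983to89.Node00
open T4Continuum
open B5Eq118OneStroke (iterBlockOf iterBlockOf_succ iterBlockOf_zero)
open ExpMeanLog (deltaSU)
open Summit.QuantumFields.YangMills.BalabanUVNodes.N07DataDownTheTower (exists_coarse_of_crossing)
open Summit.QuantumFields.YangMills.BalabanUVNodes.N07Lemma1CrossingBondsAtRecord (dist1_crossingBond_le_at_record)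

/-! ## §1  The chain of a fine bond through the block hierarchy -/

section Chain

variable {P : Params}

/-- **THE CHAIN ENDS OVER THE FAR END**: if the two ends of the fine bond `b` have different block points at every height `i + 1 ≤ m` (`m ≤ m_P + K_P`), the level-`m` chain bond
`c_m := ⟨iterBlockOf m b₋, dir b⟩` has `(c_m)₊ = iterBlockOf m b₊` — induction on `m` with FILE 5's `exists_coarse_of_crossing`. [cite: Balaban1985RegularSpaces, (1.23) p.79; Balaban1987RG1, (0.3) p.252] -/
theorem chain_tgt (b : PBond P 0) :
    ∀ m : ℕ, m ≤ P.m + P.K → (∀ i < m, iterBlockOf (i + 1) b.src ≠ iterBlockOf (i + 1) b.tgt) →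
      (⟨iterBlockOf m b.src, b.dir⟩ : PBond P m).tgt = iterBlockOf m b.tgt
  | 0, _, _ => rfl
  | m + 1, hm, hcross => by
      have ih := chain_tgt b m (Nat.le_of_succ_le hm) (fun i hi => hcross i (Nat.lt_succ_of_lt hi))
      have hne : blockOf ((⟨iterBlockOf m b.src, b.dir⟩ : PBond P m).tgt) ≠ blockOf ((⟨iterBlockOf m b.src, b.dir⟩ : PBond P m).src) := by
        rw [ih]
        show iterBlockOf (m + 1) b.tgt ≠ iterBlockOf (m + 1) b.src
        exact (hcross m (Nat.lt_succ_self m)).symm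
      have h := (exists_coarse_of_crossing hm ⟨iterBlockOf m b.src, b.dir⟩ hne).1
      rw [ih] at h
      exact h

/-- Under windows nested under blocking, the chain of a fine bond whose ends lie in the bottom window stays in the windows at every height `i ≤ m`.
[cite: Balaban1985RegularSpaces, (1.131) p.99 (bookkeeping)] -/
theorem chain_mem_window (W : ∀ i : ℕ, Set (Site P i)) {m : ℕ} (hnest : ∀ i < m, ∀ x : Site P i, x ∈ W i → blockOf x ∈ W (i + 1))
    {x : Site P 0} (hx : x ∈ W 0) : ∀ i ≤ m, iterBlockOf i x ∈ W i
  | 0, _ => hx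
  | i + 1, hi => by
      rw [iterBlockOf_succ]
      exact hnest i (by omega) _ (chain_mem_window W hnest hx i (by omega))

end Chain

/-! ## §2  The descent along the chain -/

section Descent

variable {F : T4Continuum.T4Family} {N : ℕ} [NeZero N] {K : ℕ}

/-- ★★★ **THE DESCENT ALONG THE CHAIN OF A FINE BOND** ([6] Lemma 1 once per crossed level, at `W := M^i(U′)`).  Any `U′`, a fine bond `b` with both ends in the bottom window `W 0`, windows
`W i` nested under blocking up to height `m ≤ m + K`, per-level plaquette letters `a_i ≥ 0` (`((d+2)L)²∕4·a_i < δ_N`) of `M^i U′` around the `(i+1)`-bonds of `W (i+1)` and within-block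
letters `τ_i ≥ 0` inside the blocks of `W (i+1)` (FILE 5's binder shapes); if the ends of `b` have different block points at every height `≤ m`, then
`dist1 (U′ b) ≤ dist1 (M^m U′ ⟨iterBlockOf m b₋, dir b⟩) + Σ_{i<m} (7·((d+2)L)²∕4·a_i + (d+1)(L−1)·τ_i)`. [cite: Balaban1985Variational, (145) p.301; Balaban1985RegularSpaces, Lemma 1 (1.25) p.79] -/
theorem dist1_fine_le_chain (U' : GaugeField (F.P K) 0 (SU N)) (W : ∀ i : ℕ, Set (Site (F.P K) i)) (a τ : ℕ → ℝ) (b : PBond (F.P K) 0)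
    (hbs : b.src ∈ W 0) (hbt : b.tgt ∈ W 0) :
    ∀ m : ℕ, m ≤ (F.P K).m + (F.P K).K →
      (∀ i < m, ∀ x : Site (F.P K) i, x ∈ W i → blockOf x ∈ W (i + 1)) →
      (∀ i < m, 0 ≤ a i) → (∀ i < m, 0 ≤ τ i) →
      (∀ i < m, (((((F.P K).d + 2) * (F.P K).L : ℕ) : ℝ) ^ 2 / 4) * a i < deltaSU (Fin N)) →
      (∀ i < m, ∀ c : PBond (F.P K) (i + 1), c.src ∈ W (i + 1) → c.tgt ∈ W (i + 1) → ∀ q : Plaq (F.P K) i,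
        (blockOf q.src = c.src.unshift c.dir ∨ blockOf q.src = c.src ∨ blockOf q.src = c.tgt) → dist1 (GaugeField.plaqHol (Averaging.iter (avOfRecord F N K) i U') q) < a i) →
      (∀ i < m, ∀ b' : PBond (F.P K) i, blockOf b'.src = blockOf b'.tgt → blockOf b'.src ∈ W (i + 1) → dist1 (Averaging.iter (avOfRecord F N K) i U' b') ≤ τ i) →
      (∀ i < m, iterBlockOf (i + 1) b.src ≠ iterBlockOf (i + 1) b.tgt) →
      dist1 (U' b) ≤ dist1 (Averaging.iter (avOfRecord F N K) m U' ⟨iterBlockOf m b.src, b.dir⟩) +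
        ∑ i ∈ Finset.range m, (7 * ((((((F.P K).d + 2) * (F.P K).L : ℕ) : ℝ) ^ 2 / 4) * a i) + ((((F.P K).d + 1) * ((F.P K).L - 1) : ℕ) : ℝ) * τ i)
  | 0, _, _, _, _, _, _, _, _ => by
      simp only [Finset.range_zero, Finset.sum_empty, add_zero]
      exact le_of_eq rfl
  | m + 1, hm, hnest, ha, hτ, ht, hplaq, hint, hcross => by
      -- descend to level `m`, then one more crossing from `m` to `m + 1`
      have ih := dist1_fine_le_chain U' W a τ b hbs hbt m (Nat.le_of_succ_le hm) (fun i hi => hnest i (by omega)) (fun i hi => ha i (by omega))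
        (fun i hi => hτ i (by omega)) (fun i hi => ht i (by omega)) (fun i hi => hplaq i (by omega)) (fun i hi => hint i (by omega)) (fun i hi => hcross i (by omega))
      -- the level-`m` chain bond crosses into the `(m+1)`-bond `c := ⟨iterBlockOf (m+1) b₋, dir b⟩`
      set cm : PBond (F.P K) m := ⟨iterBlockOf m b.src, b.dir⟩ with hcm
      have htgt : cm.tgt = iterBlockOf m b.tgt := chain_tgt b m (Nat.le_of_succ_le hm) (fun i hi => hcross i (by omega))
      have hne : blockOf cm.tgt ≠ blockOf cm.src := by
        rw [htgt]; show iterBlockOf (m + 1) b.tgt ≠ iterBlockOf (m + 1) b.src; exact (hcross m (Nat.lt_succ_self m)).symm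
      obtain ⟨hct, r, hr, hbr⟩ := exists_coarse_of_crossing hm cm hne
      set c : PBond (F.P K) (m + 1) := ⟨blockOf cm.src, cm.dir⟩ with hc
      have hcs : c.src ∈ W (m + 1) := hnest m (Nat.lt_succ_self m) _ (chain_mem_window W (m := m) (fun i hi => hnest i (by omega)) hbs m le_rfl)
      have hctg : c.tgt ∈ W (m + 1) := by
        rw [hct, htgt]; exact hnest m (Nat.lt_succ_self m) _ (chain_mem_window W (m := m) (fun i hi => hnest i (by omega)) hbt m le_rfl)
      have hstep := dist1_crossingBond_le_at_record (F := F) (N := N) hm (ha m (Nat.lt_succ_self m)) (hτ m (Nat.lt_succ_self m)) c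
        (hplaq m (Nat.lt_succ_self m) c hcs hctg) (ht m (Nat.lt_succ_self m)) le_rfl
        (fun b' hb' hbc => hint m (Nat.lt_succ_self m) b' hb' (by rcases hbc with h | h <;> [exact h ▸ hcs; exact h ▸ hctg])) r hr (Equiv.refl _) (Equiv.refl _)
      -- `cm = ⟨blockSite c₋ r, dir⟩` and `c = ⟨iterBlockOf (m+1) b₋, dir b⟩`
      have hcm' : dist1 (Averaging.iter (avOfRecord F N K) m U' cm) ≤
          dist1 (Averaging.iter (avOfRecord F N K) (m + 1) U' c) + 7 * ((((((F.P K).d + 2) * (F.P K).L : ℕ) : ℝ) ^ 2 / 4) * a m) +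
            ((((F.P K).d + 1) * ((F.P K).L - 1) : ℕ) : ℝ) * τ m := by
        rw [hbr]; exact hstep
      rw [Finset.sum_range_succ]
      have hcc : (⟨iterBlockOf (m + 1) b.src, b.dir⟩ : PBond (F.P K) (m + 1)) = c := rfl
      rw [hcc]
      linarith

end Descent

/-! ## §3  The two terminations: within a block at the coarsest crossed face, or at the top -/

section Terminal

variable {F : T4Continuum.T4Family} {N : ℕ} [NeZero N] {K : ℕ}

/-- ★★★ **THE FINE-BOND LETTER BY THE COARSEST CROSSED FACE**: in the setting of `dist1_fine_le_chain` up to height `m` with the within-block letter also at level `m` (windows up to `m + 1`), if the ends of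
`b` SHARE their block point at height `m + 1` (the coarsest crossed face has level `m`), then `dist1 (U′ b) ≤ τ_m + Σ_{i<m} (7t_i + (d+1)(L−1)τ_i)` — the letter decays with the level of the coarsest
crossed face when the per-level letters do. [cite: Balaban1985Variational, (145) p.301; Balaban1985RegularSpaces, (1.15) p.78, Lemma 1 (1.25) p.79] -/
theorem dist1_fine_le_of_coarsestFace (U' : GaugeField (F.P K) 0 (SU N)) (W : ∀ i : ℕ, Set (Site (F.P K) i)) (a τ : ℕ → ℝ) (b : PBond (F.P K) 0)
    (hbs : b.src ∈ W 0) (hbt : b.tgt ∈ W 0) {m : ℕ} (hm : m + 1 ≤ (F.P K).m + (F.P K).K)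
    (hnest : ∀ i < m + 1, ∀ x : Site (F.P K) i, x ∈ W i → blockOf x ∈ W (i + 1))
    (ha : ∀ i < m, 0 ≤ a i) (hτ : ∀ i < m, 0 ≤ τ i)
    (ht : ∀ i < m, (((((F.P K).d + 2) * (F.P K).L : ℕ) : ℝ) ^ 2 / 4) * a i < deltaSU (Fin N))
    (hplaq : ∀ i < m, ∀ c : PBond (F.P K) (i + 1), c.src ∈ W (i + 1) → c.tgt ∈ W (i + 1) → ∀ q : Plaq (F.P K) i,
      (blockOf q.src = c.src.unshift c.dir ∨ blockOf q.src = c.src ∨ blockOf q.src = c.tgt) → dist1 (GaugeField.plaqHol (Averaging.iter (avOfRecord F N K) i U') q) < a i)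
    (hint : ∀ i < m + 1, ∀ b' : PBond (F.P K) i, blockOf b'.src = blockOf b'.tgt → blockOf b'.src ∈ W (i + 1) → dist1 (Averaging.iter (avOfRecord F N K) i U' b') ≤ τ i)
    (hcross : ∀ i < m, iterBlockOf (i + 1) b.src ≠ iterBlockOf (i + 1) b.tgt) (hstop : iterBlockOf (m + 1) b.src = iterBlockOf (m + 1) b.tgt) :
    dist1 (U' b) ≤ τ m + ∑ i ∈ Finset.range m, (7 * ((((((F.P K).d + 2) * (F.P K).L : ℕ) : ℝ) ^ 2 / 4) * a i) + ((((F.P K).d + 1) * ((F.P K).L - 1) : ℕ) : ℝ) * τ i) := by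
  have hchain := dist1_fine_le_chain U' W a τ b hbs hbt m (Nat.le_of_succ_le hm) (fun i hi => hnest i (by omega)) ha hτ ht hplaq (fun i hi => hint i (by omega)) hcross
  have htgt : (⟨iterBlockOf m b.src, b.dir⟩ : PBond (F.P K) m).tgt = iterBlockOf m b.tgt := chain_tgt b m (Nat.le_of_succ_le hm) hcross
  have hwithin : blockOf ((⟨iterBlockOf m b.src, b.dir⟩ : PBond (F.P K) m).src) = blockOf ((⟨iterBlockOf m b.src, b.dir⟩ : PBond (F.P K) m).tgt) := by
    rw [htgt]; exact hstop
  have hmem : blockOf ((⟨iterBlockOf m b.src, b.dir⟩ : PBond (F.P K) m).src) ∈ W (m + 1) :=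
    hnest m (Nat.lt_succ_self m) _ (chain_mem_window W (m := m) (fun i hi => hnest i (by omega)) hbs m le_rfl)
  have hτm := hint m (Nat.lt_succ_self m) _ hwithin hmem
  linarith

/-- ★★ **THE CHAIN THAT REACHES THE TOP**: if the ends of `b` have different block points at every height `≤ k` (`k ≤ m + K`, windows nested up to `k`) and the top letter `dist1 (M^k U′ c) ≤ v_k` holds on
the `k`-bonds of the top window, then `dist1 (U′ b) ≤ v_k + Σ_{i<k} (7t_i + (d+1)(L−1)τ_i)`. [cite: Balaban1985Variational, (145) p.301, (151) p.301] -/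
theorem dist1_fine_le_of_top (U' : GaugeField (F.P K) 0 (SU N)) (W : ∀ i : ℕ, Set (Site (F.P K) i)) (a τ : ℕ → ℝ) (b : PBond (F.P K) 0)
    (hbs : b.src ∈ W 0) (hbt : b.tgt ∈ W 0) {k : ℕ} (hk : k ≤ (F.P K).m + (F.P K).K)
    (hnest : ∀ i < k, ∀ x : Site (F.P K) i, x ∈ W i → blockOf x ∈ W (i + 1))
    (ha : ∀ i < k, 0 ≤ a i) (hτ : ∀ i < k, 0 ≤ τ i)
    (ht : ∀ i < k, (((((F.P K).d + 2) * (F.P K).L : ℕ) : ℝ) ^ 2 / 4) * a i < deltaSU (Fin N))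
    (hplaq : ∀ i < k, ∀ c : PBond (F.P K) (i + 1), c.src ∈ W (i + 1) → c.tgt ∈ W (i + 1) → ∀ q : Plaq (F.P K) i,
      (blockOf q.src = c.src.unshift c.dir ∨ blockOf q.src = c.src ∨ blockOf q.src = c.tgt) → dist1 (GaugeField.plaqHol (Averaging.iter (avOfRecord F N K) i U') q) < a i)
    (hint : ∀ i < k, ∀ b' : PBond (F.P K) i, blockOf b'.src = blockOf b'.tgt → blockOf b'.src ∈ W (i + 1) → dist1 (Averaging.iter (avOfRecord F N K) i U' b') ≤ τ i)
    (hcross : ∀ i < k, iterBlockOf (i + 1) b.src ≠ iterBlockOf (i + 1) b.tgt) {v : ℝ}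
    (htop : ∀ c : PBond (F.P K) k, c.src ∈ W k → c.tgt ∈ W k → dist1 (Averaging.iter (avOfRecord F N K) k U' c) ≤ v) :
    dist1 (U' b) ≤ v + ∑ i ∈ Finset.range k, (7 * ((((((F.P K).d + 2) * (F.P K).L : ℕ) : ℝ) ^ 2 / 4) * a i) + ((((F.P K).d + 1) * ((F.P K).L - 1) : ℕ) : ℝ) * τ i) := by
  have hchain := dist1_fine_le_chain U' W a τ b hbs hbt k hk hnest ha hτ ht hplaq hint hcross
  have htgt : (⟨iterBlockOf k b.src, b.dir⟩ : PBond (F.P K) k).tgt = iterBlockOf k b.tgt := chain_tgt b k hk hcross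
  have hs : (⟨iterBlockOf k b.src, b.dir⟩ : PBond (F.P K) k).src ∈ W k := chain_mem_window W hnest hbs k le_rfl
  have htg : (⟨iterBlockOf k b.src, b.dir⟩ : PBond (F.P K) k).tgt ∈ W k := by rw [htgt]; exact chain_mem_window W hnest hbt k le_rfl
  have hv := htop _ hs htg
  linarith

/-- The degenerate chain `m = 0`: a fine bond inside one block is bounded by the bottom within-block letter alone. [cite: Balaban1985RegularSpaces, (1.15) p.78] -/
theorem dist1_fine_le_within (U' : GaugeField (F.P K) 0 (SU N)) (W₁ : Set (Site (F.P K) 1)) {τ₀ : ℝ} (b : PBond (F.P K) 0)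
    (hint : ∀ b' : PBond (F.P K) 0, blockOf b'.src = blockOf b'.tgt → blockOf b'.src ∈ W₁ → dist1 (Averaging.iter (avOfRecord F N K) 0 U' b') ≤ τ₀)
    (hstop : blockOf b.src = blockOf b.tgt) (hmem : blockOf b.src ∈ W₁) : dist1 (U' b) ≤ τ₀ :=
  hint b hstop hmem

end Terminal

end Summit.QuantumFields.YangMills.BalabanUVNodes.N07FineBondByCoarsestFace
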